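import Literature.NumberTheory.ConnesConsani2021.CutoffScalingKernel
import Literature.NumberTheory.ConnesConsani2021.CosineTail
import HarnessLib

/-!
# Connes–Consani 2021, Prop. 2.2 (iii) discharge (R49/R58), step A3–B interface:
# the kernel `k_g` of `P𝓕Pϑ(g)E` in logarithmic coordinates and the reduction of
# `CC2021_prop_2_2_iii` to the COSINE-TAIL ENERGY identity (RH-FREE)

A. Connes, C. Consani, *Weil positivity and trace formula, the archimedean place*, Selecta Math. (N.S.)
27 (2021) 77 = arXiv:2006.13771 [bib: `ConnesConsani2021`], §2 Prop. 2.2 (iii) p. 10 (named fact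
`CC2021_prop_2_2_iii`).  Cell `rh-crit/cc`, seat gm-t15 (lead writer); the definition `cosTail` and its
elementary API are the cell's `CosineTail.lean` (seat t1), the analytic identity is `CosineTailEnergy.lean`
(seat gm-t13).

With `k_g = cutoffScalingKernel g` (`CutoffScalingKernel.lean`) the substitution `x = e^v/|ξ|` in the
column integral gives, for `|ξ| ≥ 1` and `y ≠ 0`,

  `k_g(ξ, y) = (|ξ||y|)^{-1/2} · cosTail g (log|ξ|) (log|ξ| + log|y|)`,
  `cosTail g s c = ∫_{v ≥ s} g(v − c) e^{v/2} cos(2π e^v) dv`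

(`cutoffScalingKernel_eq_cosTail`: the kernel of `(1 − P)(u^g)P` of the printed proof, p. 10, is
`2λ^{-1/2}μ^{1/2}cos(2πμ/λ)` — Lemma 1.4 (i) — and this is its `L²(ℝ)`-picture column after the cutoffs),
and then `dξ dy/(|ξ||y|) = ds dc` turns the Hilbert–Schmidt norm into

  `∫∫ |k_g(ξ,y)|² dy dξ = 4 ∫_{s ≥ 0} ∫_ℝ |cosTail g s c|² dc ds`

(`lintegral_cutoffScalingKernel_eq`, Tonelli + two one-dimensional changes of variables).  Hence
(`CC2021_prop_2_2_iii_of_cosTail_energy`) **`CC2021_prop_2_2_iii` follows from the two statements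
(T1) `(s,c) ↦ |cosTail g s c|²` is integrable on `[0,∞) × ℝ` and
(T2) `4 ∫∫ |cosTail g s c|² = Re L(g ∗ g*)` for every test function `g`** — the content of the printed
proof (Prop. 1.5, Lemma 1.4 (iii), Prop. 2.2 (i)–(iii): the square `Δ` gives `D`, Weil's principal value
gives `W_∞`), taken here as hypotheses (theorems of `CosineTailEnergy.lean`, not named facts).

Theorems only; no definition, no named fact, no instance, no `sorry`.  Net debt delta 0.
bears_on: W-C/W-P (K1 boundary fact `CC2021_prop_2_2_iii`).  WHAT THIS IS NOT: any claim about RH —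
a change of variables in an archimedean Hilbert–Schmidt integral; nothing here bears on the truth of RH.

## References
* A. Connes, C. Consani, Selecta Math. (N.S.) 27 (2021) 77 = arXiv:2006.13771, §1 Lemma 1.4 (i) p. 7,
  §2 Prop. 2.2 (iii) and its proof p. 10 (chunk p0010:L20–L75). [ConnesConsani2021]
* M. Reed, B. Simon, *Methods of Modern Mathematical Physics I* (1972), Thm. VI.23. [ReedSimon1972]
-/

noncomputable section

open MeasureTheory Complex Set Filter Function
open scoped Real ComplexConjugate ENNReal InnerProductSpace Topology FourierTransform

namespace Literature.NumberTheory.ConnesConsani2021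

open Literature.NumberTheory.LFunctions Literature.Analysis.OperatorTheory

variable {g : ℝ → ℂ}

/-! ## The kernel `k_g` in logarithmic coordinates -/

/-- `κ_g` is even in its first variable. [cite: ConnesConsani2021, §1 Remark 1.2 p. 7] -/
theorem evenScalingKernel_neg_left (x y : ℝ) : evenScalingKernel g (-x) y = evenScalingKernel g x y := by
  unfold evenScalingKernel
  rw [neg_neg, add_comm]

/-- `1_{|x|≥1}κ_g(x,y)` is even in `x`. [cite: ConnesConsani2021, §1 Remark 1.2 p. 7] -/
theorem cutoffEvenScalingKernel_neg_left (x y : ℝ) :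
    cutoffEvenScalingKernel g (-x) y = cutoffEvenScalingKernel g x y := by
  unfold cutoffEvenScalingKernel
  rw [abs_neg, evenScalingKernel_neg_left]

/-- A bounded, a.e.-strongly measurable function vanishing off a bounded interval is integrable. [folklore] -/
private theorem integrable_of_norm_le_of_eq_zero' {E : Type*} [NormedAddCommGroup E] {f : ℝ → E}
    (hf : AEStronglyMeasurable f volume) {M R : ℝ} (hM : ∀ x, ‖f x‖ ≤ M)
    (hR : ∀ x, R < |x| → f x = 0) : Integrable f volume := by
  have hs : IntegrableOn f (Icc (-R) R) volume :=
    Measure.integrableOn_of_bounded (by rw [Real.volume_Icc]; exact ENNReal.ofReal_ne_top) hf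
      (ae_of_all _ fun x => hM x)
  refine hs.integrable_of_forall_notMem_eq_zero fun x hx => hR x ?_
  simp only [mem_Icc, not_and_or, not_le] at hx
  rcases hx with h | h
  · calc R < -x := by linarith
      _ ≤ |x| := neg_le_abs x
  · exact h.trans_le (le_abs_self x)

/-- The column `x ↦ 1_{|x|≥1}κ_g(x,y)` is integrable (bounded with compact support) for `g ∈ C_c`.
[cite: ConnesConsani2021, §2 Prop. 2.2 (iii) proof p. 10] -/
theorem integrable_cutoffEvenScalingKernel_left (hg : Continuous g) (hgs : HasCompactSupport g) (y : ℝ) :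
    Integrable (fun x => cutoffEvenScalingKernel g x y) (volume : Measure ℝ) := by
  obtain ⟨M, hM⟩ := hg.bounded_above_of_compact_support hgs
  obtain ⟨T, -, hT⟩ := hgs.exists_pos_le_norm
  have hT' : ∀ t, T ≤ |t| → g t = 0 := fun t ht => hT t (by simpa using ht)
  refine integrable_of_norm_le_of_eq_zero' ?_ (M := M * Real.exp (T / 2)) (R := |y| * Real.exp T)
    (fun x => norm_cutoffEvenScalingKernel_le hM hT' x y)
    (fun x hx => cutoffEvenScalingKernel_eq_zero_of_lt hT' hx)
  exact ((measurable_cutoffEvenScalingKernel hg.measurable).comp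
    (measurable_id.prodMk measurable_const)).aestronglyMeasurable

/-- Folding a line integral onto the half-line: `∫_ℝ F = ∫_{(0,∞)} (F(x) + F(−x)) dx`. [folklore] -/
private theorem integral_eq_integral_Ioi_add_neg {F : ℝ → ℂ} (hF : Integrable F (volume : Measure ℝ)) :
    ∫ x, F x = ∫ x in Ioi 0, (F x + F (-x)) := by
  rw [← integral_add_compl (measurableSet_Ioi (a := (0 : ℝ))) hF, compl_Ioi,
    integral_add hF.integrableOn hF.comp_neg.integrableOn]
  congr 1
  have h := integral_comp_neg_Ioi 0 F
  rw [neg_zero] at h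
  exact h.symm

/-- `e^{−ia} + e^{ia} = 2 cos a`. [folklore] -/
private theorem cexp_neg_add_cexp (a : ℝ) :
    cexp (↑(-a) * I) + cexp (↑a * I) = ((2 * Real.cos a : ℝ) : ℂ) := by
  rw [Complex.ofReal_mul, Complex.ofReal_ofNat, Complex.ofReal_cos, Complex.two_cos, add_comm,
    Complex.ofReal_neg, neg_mul]

/-- The scalar bookkeeping of the substitution `x = e^v/|ξ|`:
`(e^v/a) · (x b)^{-1/2} = (ab)^{-1/2} e^{v/2}` for `x = e^v/a`. [folklore] -/
private theorem exp_div_mul_sqrt_inv {a b : ℝ} (ha : 0 < a) (hb : 0 < b) (v : ℝ) :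
    Real.exp v / a * (Real.sqrt (Real.exp v / a * b))⁻¹ = (Real.sqrt (a * b))⁻¹ * Real.exp (v / 2) := by
  obtain ⟨A, hA, rfl⟩ : ∃ A, 0 < A ∧ a = A ^ 2 := ⟨Real.sqrt a, Real.sqrt_pos.mpr ha, (Real.sq_sqrt ha.le).symm⟩
  obtain ⟨B, hB, rfl⟩ : ∃ B, 0 < B ∧ b = B ^ 2 := ⟨Real.sqrt b, Real.sqrt_pos.mpr hb, (Real.sq_sqrt hb.le).symm⟩
  set E := Real.exp (v / 2) with hE
  have hE0 : 0 < E := Real.exp_pos _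
  have hv : Real.exp v = E ^ 2 := by rw [hE, sq, ← Real.exp_add]; ring_nf
  rw [hv, show E ^ 2 / A ^ 2 * B ^ 2 = (E * B / A) ^ 2 by ring, Real.sqrt_sq (by positivity),
    show A ^ 2 * B ^ 2 = (A * B) ^ 2 by ring, Real.sqrt_sq (by positivity)]
  field_simp

/-- The substitution map `c ↦ e^c/a`: derivative. [folklore] -/
private theorem hasDerivWithinAt_exp_div (a c : ℝ) :
    HasDerivWithinAt (fun c : ℝ => Real.exp c / a) (Real.exp c / a) univ c :=
  ((Real.hasDerivAt_exp c).div_const a).hasDerivWithinAt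

/-- The substitution map `c ↦ e^c/a` (`a > 0`) is injective. [folklore] -/
private theorem injOn_exp_div {a : ℝ} (ha : 0 < a) : InjOn (fun c : ℝ => Real.exp c / a) univ := by
  intro c _ c' _ h
  exact Real.exp_injective ((div_left_inj' ha.ne').mp h)

/-- The substitution map `c ↦ e^c/a` (`a > 0`) maps `ℝ` onto `(0, ∞)`. [folklore] -/
private theorem image_exp_div {a : ℝ} (ha : 0 < a) : (fun c : ℝ => Real.exp c / a) '' univ = Ioi 0 := by
  ext x
  simp only [image_univ, mem_range, mem_Ioi]
  constructor
  · rintro ⟨c, rfl⟩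
    exact div_pos (Real.exp_pos c) ha
  · intro hx
    exact ⟨Real.log (x * a), by rw [Real.exp_log (mul_pos hx ha), mul_div_cancel_right₀ _ ha.ne']⟩

/-- **The kernel `k_g` in logarithmic coordinates** (the substitution `x = e^v/|ξ|` in the column
integral): for `|ξ| ≥ 1` and `y ≠ 0`,
`k_g(ξ, y) = (|ξ||y|)^{-1/2} · cosTail g (log|ξ|) (log|ξ| + log|y|)`.
[cite: ConnesConsani2021, §1 Lemma 1.4 (i) p. 7; §2 Prop. 2.2 (iii) proof p. 10 (chunk p0010:L28–L40)] -/
theorem cutoffScalingKernel_eq_cosTail (hg : Continuous g) (hgs : HasCompactSupport g)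
    {ξ y : ℝ} (hξ : 1 ≤ |ξ|) (hy : y ≠ 0) :
    cutoffScalingKernel g ξ y =
      (((Real.sqrt (|ξ| * |y|))⁻¹ : ℝ) : ℂ) * cosTail g (Real.log |ξ|) (Real.log |ξ| + Real.log |y|) := by
  have hξ0 : 0 < |ξ| := one_pos.trans_le hξ
  have hξne : ξ ≠ 0 := abs_pos.mp hξ0
  have hy0 : 0 < |y| := abs_pos.mpr hy
  rw [cutoffScalingKernel_of_le hξ]
  -- Step 1: fold onto `(0, ∞)`; the two exponentials add up to a cosine
  set F : ℝ → ℂ := fun x => cexp (↑(-2 * π * x * ξ) * I) * cutoffEvenScalingKernel g x y with hF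
  have hFi : Integrable F (volume : Measure ℝ) := by
    refine (integrable_cutoffEvenScalingKernel_left hg hgs y).bdd_mul (c := 1) ?_
      (ae_of_all _ fun x => ?_)
    · exact (Complex.continuous_exp.comp ((continuous_ofReal.comp (by fun_prop)).mul
        continuous_const)).aestronglyMeasurable
    · rw [Complex.norm_exp_ofReal_mul_I]
  have hsum : ∀ x, F x + F (-x)
      = ((2 * Real.cos (2 * π * x * ξ) : ℝ) : ℂ) * cutoffEvenScalingKernel g x y := by
    intro x
    simp only [hF, cutoffEvenScalingKernel_neg_left]
    rw [← add_mul, show (-2 * π * x * ξ : ℝ) = -(2 * π * x * ξ) by ring,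
      show (-2 * π * (-x) * ξ : ℝ) = 2 * π * x * ξ by ring, cexp_neg_add_cexp]
  rw [show (∫ x, cexp (↑(-2 * π * x * ξ) * I) * cutoffEvenScalingKernel g x y) = ∫ x, F x from rfl,
    integral_eq_integral_Ioi_add_neg hFi]
  simp_rw [hsum]
  -- Step 2: substitute `x = e^v/|ξ|`, `v ∈ ℝ`
  have hcv := integral_image_eq_integral_abs_deriv_smul MeasurableSet.univ
    (fun v _ => hasDerivWithinAt_exp_div |ξ| v) (injOn_exp_div hξ0)
    (fun x => ((2 * Real.cos (2 * π * x * ξ) : ℝ) : ℂ) * cutoffEvenScalingKernel g x y)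
  rw [image_exp_div hξ0, Measure.restrict_univ] at hcv
  rw [hcv]
  -- Step 3: pointwise, and restriction to `v ≥ log |ξ|`
  unfold cosTail
  rw [← integral_const_mul, ← integral_indicator measurableSet_Ici]
  refine integral_congr_ae (ae_of_all _ fun v => ?_)
  simp only
  have hx0 : 0 < Real.exp v / |ξ| := div_pos (Real.exp_pos v) hξ0
  by_cases hv : Real.log |ξ| ≤ v
  · -- on the cutoff: `x = e^v/|ξ| ≥ 1`
    have hx1 : 1 ≤ |(Real.exp v / |ξ|)| := by
      rw [abs_of_pos hx0, le_div_iff₀ hξ0, one_mul, ← Real.exp_log hξ0]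
      exact Real.exp_le_exp.mpr hv
    rw [indicator_of_mem (mem_Ici.mpr hv), cutoffEvenScalingKernel_of_le hx1,
      evenScalingKernel_eq hx0.ne' hy, abs_of_pos hx0]
    -- the cosine: `cos(2π x ξ) = cos(2π e^v)`
    have hcos : Real.cos (2 * π * (Real.exp v / |ξ|) * ξ) = Real.cos (2 * π * Real.exp v) := by
      rcases lt_or_gt_of_ne hξne with hneg | hpos
      · rw [abs_of_neg hneg, div_neg, mul_neg, neg_mul, mul_assoc (2 * π) (Real.exp v / ξ) ξ,
          div_mul_cancel₀ _ hξne, Real.cos_neg]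
      · rw [abs_of_pos hpos, mul_assoc (2 * π) (Real.exp v / ξ) ξ, div_mul_cancel₀ _ hξne]
    -- the logarithm: `log(x/|y|) = v − log|ξ| − log|y|`
    have hlog : Real.log (Real.exp v / |ξ| / |y|) = v - (Real.log |ξ| + Real.log |y|) := by
      rw [Real.log_div hx0.ne' hy0.ne', Real.log_div (Real.exp_pos v).ne' hξ0.ne', Real.log_exp]
      ring
    rw [hcos, hlog, Complex.real_smul]
    -- the scalars: `(e^v/|ξ|) · 2cos · ½ · (x|y|)^{-1/2} = (|ξ||y|)^{-1/2} e^{v/2} cos`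
    have hscalC := congrArg (fun r : ℝ => (r : ℂ)) (exp_div_mul_sqrt_inv hξ0 hy0 v)
    simp only [Complex.ofReal_mul, Complex.ofReal_inv, Complex.ofReal_div, Complex.ofReal_ofNat] at hscalC ⊢
    linear_combination
      ((Real.cos (2 * π * Real.exp v) : ℂ) * g (v - (Real.log |ξ| + Real.log |y|))) * hscalC
  · -- off the cutoff: `x < 1`
    have hx1 : |(Real.exp v / |ξ|)| < 1 := by
      rw [abs_of_pos hx0, div_lt_iff₀ hξ0, one_mul, ← Real.exp_log hξ0]
      exact Real.exp_lt_exp.mpr (not_le.mp hv)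
    rw [indicator_of_notMem (fun h => hv (mem_Ici.mp h)), cutoffEvenScalingKernel_of_lt hx1,
      mul_zero, smul_zero]

/-! ## The energy identity `∫∫ |k_g|² = 4 ∫_{s≥0}∫ |cosTail g s c|²` -/

/-- Folding an even `ℝ≥0∞`-valued integrand onto `(0, ∞)`. [folklore] -/
private theorem lintegral_eq_two_mul_lintegral_Ioi {H : ℝ → ℝ≥0∞} (hH : ∀ y, H (-y) = H y) :
    ∫⁻ y, H y = 2 * ∫⁻ y in Ioi 0, H y := by
  rw [← lintegral_add_compl H (measurableSet_Ioi (a := (0 : ℝ))), compl_Ioi, two_mul]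
  congr 1
  rw [setLIntegral_congr (Iio_ae_eq_Iic (a := (0 : ℝ)) (μ := (volume : Measure ℝ))).symm]
  have h := (Measure.measurePreserving_neg (volume : Measure ℝ)).setLIntegral_comp_preimage_emb
    (Homeomorph.neg ℝ).measurableEmbedding H (Ioi 0)
  have hpre : (Neg.neg ⁻¹' Ioi (0 : ℝ)) = Iio 0 := by
    ext a
    simp
  rw [hpre] at h
  simp_rw [hH] at h
  exact h

/-- **The column energy**: for `|ξ| ≥ 1`, `∫ |k_g(ξ,y)|² dy = (2/|ξ|) ∫ |cosTail g (log|ξ|) c|² dc`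
(the substitution `y = ±e^c/|ξ|`). [cite: ConnesConsani2021, §2 Prop. 2.2 (iii) proof p. 10 (chunk p0010:L28–L40)] -/
theorem lintegral_enorm_sq_cutoffScalingKernel (hg : Continuous g) (hgs : HasCompactSupport g) {ξ : ℝ}
    (hξ : 1 ≤ |ξ|) :
    ∫⁻ y, ‖cutoffScalingKernel g ξ y‖ₑ ^ 2
      = ENNReal.ofReal (2 / |ξ|) * ∫⁻ c, ‖cosTail g (Real.log |ξ|) c‖ₑ ^ 2 := by
  have hξ0 : 0 < |ξ| := one_pos.trans_le hξ
  set L := Real.log |ξ| with hL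
  set H : ℝ → ℝ≥0∞ := fun y =>
    ENNReal.ofReal ((|ξ| * |y|)⁻¹) * ‖cosTail g L (L + Real.log |y|)‖ₑ ^ 2 with hH
  -- a.e. `y` (`y ≠ 0`) the integrand is `H y`
  have hae : (fun y => ‖cutoffScalingKernel g ξ y‖ₑ ^ 2) =ᵐ[volume] H := by
    have h0 : ∀ᵐ y : ℝ ∂(volume : Measure ℝ), y ≠ 0 := by
      have : (volume : Measure ℝ) {y | ¬ y ≠ 0} = 0 := by
        simp only [not_not, setOf_eq_eq_singleton, measure_singleton]
      exact this
    filter_upwards [h0] with y hy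
    rw [cutoffScalingKernel_eq_cosTail hg hgs hξ hy, enorm_mul, mul_pow]
    congr 1
    rw [← ofReal_norm, Complex.norm_real, Real.norm_eq_abs,
      abs_of_nonneg (inv_nonneg.mpr (Real.sqrt_nonneg _)),
      ← ENNReal.ofReal_pow (inv_nonneg.mpr (Real.sqrt_nonneg _)), inv_pow,
      Real.sq_sqrt (by positivity)]
  rw [lintegral_congr_ae hae, lintegral_eq_two_mul_lintegral_Ioi (fun y => by simp only [hH, abs_neg])]
  -- substitute `y = e^c/|ξ|` on `(0, ∞)`
  have hcv := lintegral_image_eq_lintegral_abs_deriv_mul MeasurableSet.univ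
    (fun c _ => hasDerivWithinAt_exp_div |ξ| c) (injOn_exp_div hξ0) H
  rw [image_exp_div hξ0, Measure.restrict_univ] at hcv
  rw [hcv]
  have hpt : ∀ c, ENNReal.ofReal |(Real.exp c / |ξ|)| * H (Real.exp c / |ξ|)
      = ENNReal.ofReal |ξ|⁻¹ * ‖cosTail g L c‖ₑ ^ 2 := by
    intro c
    have hx0 : 0 < Real.exp c / |ξ| := div_pos (Real.exp_pos c) hξ0
    simp only [hH, abs_div, abs_abs, Real.abs_exp]
    rw [← mul_assoc, ← ENNReal.ofReal_mul hx0.le]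
    congr 2
    · field_simp
    · rw [Real.log_div (Real.exp_pos c).ne' hξ0.ne', Real.log_exp, hL]
      ring
  simp_rw [hpt]
  rw [lintegral_const_mul' _ _ ENNReal.ofReal_ne_top, ← mul_assoc]
  congr 1
  rw [show (2 : ℝ≥0∞) = ENNReal.ofReal 2 by simp, ← ENNReal.ofReal_mul (by norm_num : (0 : ℝ) ≤ 2),
    ← div_eq_mul_inv]

/-- **The energy identity**: `∫∫ |k_g(ξ, y)|² dy dξ = 4 ∫_{s ≥ 0} ∫_ℝ |cosTail g s c|² dc ds` (as Lebesgue
integrals in `[0, ∞]`: Tonelli, the column energy, and the substitution `ξ = ±e^s`).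
[cite: ConnesConsani2021, §2 Prop. 2.2 (iii) proof p. 10 (chunk p0010:L28–L75)] [cite: ReedSimon1972, Thm. VI.23, PDF pp. 198–199] -/
theorem lintegral_cutoffScalingKernel_eq (hg : Continuous g) (hgs : HasCompactSupport g) :
    ∫⁻ p, ‖uncurry (cutoffScalingKernel g) p‖ₑ ^ 2 ∂((volume : Measure ℝ).prod volume)
      = 4 * ∫⁻ p, ‖cosTail g p.1 p.2‖ₑ ^ 2
          ∂(((volume : Measure ℝ).restrict (Ici 0)).prod (volume : Measure ℝ)) := by
  rw [lintegral_prod _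
    ((measurable_cutoffScalingKernel hg.measurable).enorm.pow_const 2).aemeasurable]
  set Φ : ℝ → ℝ≥0∞ := fun s => ∫⁻ c, ‖cosTail g s c‖ₑ ^ 2 with hΦ
  have hinner : ∀ ξ : ℝ, ∫⁻ y, ‖uncurry (cutoffScalingKernel g) (ξ, y)‖ₑ ^ 2
      = (Ici (1 : ℝ)).indicator (fun ξ => ENNReal.ofReal (2 / ξ) * Φ (Real.log ξ)) |ξ| := by
    intro ξ
    simp only [uncurry]
    by_cases hξ : 1 ≤ |ξ|
    · rw [indicator_of_mem (mem_Ici.mpr hξ), lintegral_enorm_sq_cutoffScalingKernel hg hgs hξ]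
    · rw [indicator_of_notMem (fun h => hξ (mem_Ici.mp h))]
      simp [cutoffScalingKernel_of_lt (not_le.mp hξ)]
  simp_rw [hinner]
  rw [lintegral_eq_two_mul_lintegral_Ioi (fun ξ => by rw [abs_neg])]
  -- substitute `ξ = e^s`
  have hcv := lintegral_image_eq_lintegral_abs_deriv_mul MeasurableSet.univ
    (fun s _ => (Real.hasDerivAt_exp s).hasDerivWithinAt) Real.exp_injective.injOn
    (fun ξ => (Ici (1 : ℝ)).indicator (fun ξ => ENNReal.ofReal (2 / ξ) * Φ (Real.log ξ)) |ξ|)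
  rw [image_univ, Real.range_exp, Measure.restrict_univ] at hcv
  rw [hcv]
  have hpt : ∀ s : ℝ, ENNReal.ofReal |Real.exp s| *
      (Ici (1 : ℝ)).indicator (fun ξ => ENNReal.ofReal (2 / ξ) * Φ (Real.log ξ)) |Real.exp s|
        = (Ici (0 : ℝ)).indicator (fun s => 2 * Φ s) s := by
    intro s
    rw [abs_of_pos (Real.exp_pos s)]
    by_cases hs : 0 ≤ s
    · rw [indicator_of_mem (mem_Ici.mpr (Real.one_le_exp hs)), indicator_of_mem (mem_Ici.mpr hs),
        Real.log_exp, ← mul_assoc, ← ENNReal.ofReal_mul (Real.exp_pos s).le,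
        mul_div_cancel₀ _ (Real.exp_pos s).ne', ENNReal.ofReal_ofNat]
    · rw [indicator_of_notMem (fun h => hs (mem_Ici.mp h)), indicator_of_notMem, mul_zero]
      intro h
      exact (not_le.mpr ((Real.exp_lt_exp.mpr (not_le.mp hs)).trans_eq Real.exp_zero)) (mem_Ici.mp h)
  simp_rw [hpt]
  rw [lintegral_indicator measurableSet_Ici, lintegral_const_mul' _ _ (by simp), ← mul_assoc,
    show (2 : ℝ≥0∞) * 2 = 4 by norm_num]
  congr 1
  rw [lintegral_prod (fun p : ℝ × ℝ => ‖cosTail g p.1 p.2‖ₑ ^ 2)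
    (by exact ((measurable_cosTail hg hgs).enorm.pow_const 2).aemeasurable)]

/-! ## `CC2021_prop_2_2_iii` from the cosine-tail energy -/

/-- **Prop. 2.2 (iii) from the COSINE-TAIL ENERGY identity.**  If for every test function `g`
(T1) `(s, c) ↦ |cosTail g s c|²` is integrable on `[0, ∞) × ℝ` and
(T2) `4 ∫_{[0,∞)×ℝ} |cosTail g s c|² = Re L(g ∗ g*)` (`traceL = archW + remainderD`), then the named fact
`CC2021_prop_2_2_iii` holds (`CC2021_prop_2_2_iii_of_kernel_energy` + `lintegral_cutoffScalingKernel_eq`).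
(T1), (T2) are the content of the printed proof — the square `Δ` (Prop. 2.2 (i)) and Weil's principal
value (Prop. 1.5 (iii)) — and are hypotheses here, proved in `CosineTailEnergy.lean`.
[cite: ConnesConsani2021, §2 Prop. 2.2 (iii) statement and proof p. 10 (chunk p0010:L20–L75)] [cite: ReedSimon1972, Thm. VI.23, PDF pp. 198–199] -/
theorem CC2021_prop_2_2_iii_of_cosTail_energy
    (H1 : ∀ g : ℝ → ℂ, IsWeilTest g →
      Integrable (fun p : ℝ × ℝ => ‖cosTail g p.1 p.2‖ ^ 2)
        (((volume : Measure ℝ).restrict (Ici 0)).prod (volume : Measure ℝ)))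
    (H2 : ∀ g : ℝ → ℂ, IsWeilTest g →
      4 * ∫ p, ‖cosTail g p.1 p.2‖ ^ 2 ∂(((volume : Measure ℝ).restrict (Ici 0)).prod (volume : Measure ℝ))
        = (traceL (weilConv g (weilReflect g))).re) :
    CC2021_prop_2_2_iii := by
  refine CC2021_prop_2_2_iii_of_kernel_energy fun g hg => ?_
  have hgc : Continuous g := hg.1.continuous
  have h1 := H1 g hg
  have h2 := H2 g hg
  -- the cosine-tail energy as a Lebesgue integral
  have hG : ∫⁻ p, ‖cosTail g p.1 p.2‖ₑ ^ 2 ∂(((volume : Measure ℝ).restrict (Ici 0)).prod (volume : Measure ℝ))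
      = ENNReal.ofReal (∫ p, ‖cosTail g p.1 p.2‖ ^ 2
          ∂(((volume : Measure ℝ).restrict (Ici 0)).prod (volume : Measure ℝ))) := by
    rw [ofReal_integral_eq_lintegral_ofReal h1 (ae_of_all _ fun p => by positivity)]
    refine lintegral_congr fun p => ?_
    rw [← ofReal_norm, ENNReal.ofReal_pow (norm_nonneg _)]
  have hk := lintegral_cutoffScalingKernel_eq hgc hg.2
  have hmeas := aestronglyMeasurable_cutoffScalingKernel (g := g) hgc.measurable
  have hconv : ∀ p : ℝ × ℝ, ENNReal.ofReal (‖uncurry (cutoffScalingKernel g) p‖ ^ 2)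
      = ‖uncurry (cutoffScalingKernel g) p‖ₑ ^ 2 := fun p => by
    rw [← ofReal_norm, ENNReal.ofReal_pow (norm_nonneg _)]
  -- (a) square integrability of `k_g`
  have hint : Integrable (fun p : ℝ × ℝ => ‖uncurry (cutoffScalingKernel g) p‖ ^ 2)
      ((volume : Measure ℝ).prod volume) := by
    refine ⟨(continuous_pow 2).comp_aestronglyMeasurable hmeas.norm, ?_⟩
    rw [hasFiniteIntegral_iff_enorm]
    have : ∫⁻ p, ‖‖uncurry (cutoffScalingKernel g) p‖ ^ 2‖ₑ ∂((volume : Measure ℝ).prod volume)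
        = ∫⁻ p, ‖uncurry (cutoffScalingKernel g) p‖ₑ ^ 2 ∂((volume : Measure ℝ).prod volume) := by
      refine lintegral_congr fun p => ?_
      rw [Real.enorm_eq_ofReal (by positivity), hconv]
    rw [this, hk, hG]
    exact ENNReal.mul_lt_top (by simp) ENNReal.ofReal_lt_top
  have hmem : MemLp (uncurry (cutoffScalingKernel g)) 2 ((volume : Measure ℝ).prod volume) :=
    (memLp_two_iff_integrable_sq_norm hmeas).2 hint
  refine ⟨hmem, ?_⟩
  -- (b) the value
  have hgoal : (∫ ξ, ∫ y, ‖cutoffScalingKernel g ξ y‖ ^ 2)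
      = ∫ z, ‖uncurry (cutoffScalingKernel g) z‖ ^ 2 ∂((volume : Measure ℝ).prod volume) := by
    rw [integral_prod _ hint]
    rfl
  rw [hgoal, integral_eq_lintegral_of_nonneg_ae (ae_of_all _ fun p => by positivity) hint.1]
  simp_rw [hconv]
  rw [hk, hG, ENNReal.toReal_mul, ENNReal.toReal_ofReal (integral_nonneg fun p => by positivity), ← h2]
  norm_num


/-- The same reduction with (T2) in ITERATED form `4 ∫_{s ≥ 0} (∫_ℝ |cosTail g s c|² dc) ds = Re L(g ∗ g*)`
(equivalent to the product-measure form under (T1), by Fubini).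
[cite: ConnesConsani2021, §2 Prop. 2.2 (iii) statement and proof p. 10 (chunk p0010:L20–L75)] -/
theorem CC2021_prop_2_2_iii_of_cosTail_energy'
    (H1 : ∀ g : ℝ → ℂ, IsWeilTest g →
      Integrable (fun p : ℝ × ℝ => ‖cosTail g p.1 p.2‖ ^ 2)
        (((volume : Measure ℝ).restrict (Ici 0)).prod (volume : Measure ℝ)))
    (H2 : ∀ g : ℝ → ℂ, IsWeilTest g →
      4 * ∫ s in Ici (0 : ℝ), ∫ c, ‖cosTail g s c‖ ^ 2 = (traceL (weilConv g (weilReflect g))).re) :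
    CC2021_prop_2_2_iii :=
  CC2021_prop_2_2_iii_of_cosTail_energy H1 fun g hg => by
    rw [integral_prod _ (H1 g hg)]
    exact H2 g hg


end Literature.NumberTheory.ConnesConsani2021

end
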